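import Mathlib
import Summits.QuantumFields.BalabanUV.Beta.UnitLatticeOmegaRowData

/-!
# `Summit.QuantumFields.BalabanUV.Beta.UnitLatticeOmegaWitness` — NON-VACUITY of the A3-loc-ω hand-off: the binder list of
# `UnitLatticeOmegaRowData.rowData_decFamilyΩ` (partition data, near-local inverses, block-local pieces with threads and
# step credits, cells with packing, budgets at the shifted rate, smallness, frozen decoration values) and of
# `termSum_decFamilyΩ_one` (resummation hypotheses, remainder budget, `1` in the disc) is JOINTLY SATISFIABLE — a one-site,
# one-cube, one-piece instance with the zero kernel, written out so that the gate checks every binder's TYPE and SHAPE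

HONEST FRAMING (page 1 of everything in this cell).  Discharging `FlowStep.BetaPertH` would make Bałaban's ultraviolet
stability UNCONDITIONAL — a constructive-QFT result; NOT the continuum limit, NOT the Clay problem.  This module
discharges nothing of `BetaPertH` and says NOTHING about Bałaban's operators: it is the cell's standing sanity check
(«binders jointly inhabited», cf. `RemainderExplicitWitness`, an4's `rowData_example`) for the gen-4 ENDs of road P3's
rider (ρ3), so that no hypothesis of the hand-off is secretly contradictory or mis-typed.  [folklore]; unit
`b2b-balaban-beta-d4-p3`, gen 4.
HONEST DEPENDENCY: continuum YM on T⁴ ⇐ BetaPertH ∧ nine spine estimates (0/9 proved); BetaPertH ⇐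
(D1) ∧ (D4) ∧ CAP+tail; G-an2-4 gates asym, D1 and NE2/3/4.

CONTENTS (0 sorry).  The toy data (`Y = B = Ω = Δ = Fin 1`, `d ≡ 0`, `h ≡ 1`, `E = univ`, `K ≡ 0`, `L ≡ 1`, no near
pieces, empty domains and threads, all budgets `0` or `1`, `κ₁ = 1`, `τ ≡ 1`); `weightHyp_zero`; **`rowData_witness`** (an
inhabitant of the conclusion of `rowData_decFamilyΩ` obtained BY APPLYING IT); **`termSum_witness`** (`termSum … 1 =
(1 + Ktot 0)⁻¹` by `termSum_decFamilyΩ_one`, its hypotheses discharged by `resummation_identity₂` on the toy data).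
NOT summit progress.
-/

open scoped BigOperators Matrix
open Finset Matrix Metric

namespace Summit.QuantumFields.BalabanUV.Beta.UnitLatticeOmegaWitness

open Summit.QuantumFields.BalabanUV.Beta.UnitLatticeWalkInversion
open Summit.QuantumFields.BalabanUV.Beta.UnitLatticeOmegaTerms
open Summit.QuantumFields.BalabanUV.Beta.UnitLatticeOmegaTube (listLen)
open Summit.QuantumFields.BalabanUV.Beta.UnitLatticeOmegaRowData
open Summit.QuantumFields.BalabanUV.Beta.AnalyticWalkSum216 (termSum)
open Summit.QuantumFields.BalabanUV.Beta.AnalyticWalkSum216RowData (RowData)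
open Literature.MathematicalPhysics.QuantumFieldTheory.Balaban1983to89.B13PerturbativeStep (wrs WRS WeightHyp)

noncomputable section

/-! ## The toy data -/

/-- The zero pseudo-metric on one site. [folklore] -/
def d0 : Fin 1 → Fin 1 → ℝ := fun _ _ => 0

/-- The constant partition function `h ≡ 1` (one cube). [folklore] -/
def h1 : Fin 1 → Fin 1 → ℝ := fun _ _ => 1

/-- The cube neighbourhood: everything. [folklore] -/
def E1 : Fin 1 → Finset (Fin 1) := fun _ => Finset.univ

/-- The zero kernel family (one piece). [folklore] -/
def K0 : Fin 1 → Matrix (Fin 1) (Fin 1) ℂ := fun _ => 0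

/-- No near pieces. [folklore] -/
def near0 : Fin 1 → Finset (Fin 1) := fun _ => ∅

/-- The local inverses: the identity. [folklore] -/
def L1 : Fin 1 → Matrix (Fin 1) (Fin 1) ℂ := fun _ => 1

/-- Empty piece domains. [folklore] -/
def Dω0 : Fin 1 → Finset (Fin 1) := fun _ => ∅

/-- Empty threads. [folklore] -/
def thr0 : Fin 1 → List (Fin 1) := fun _ => []

/-- Zero step credits. [folklore] -/
def cr0 : Fin 1 → ℝ := fun _ => 0

/-- The zero pseudo-metric satisfies the weight hypotheses at every nonnegative rate. [folklore] -/
theorem weightHyp_zero {κ : ℝ} (hκ : 0 ≤ κ) : WeightHyp κ d0 where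
  κ_nonneg := hκ
  zero _ := rfl
  nonneg _ _ := le_rfl
  tri _ _ _ := by simp [d0]

/-- `WRS κ d0 1 1` (the identity has weighted row sums `1`). [folklore] -/
theorem wrs_L1 {κ : ℝ} (hκ : 0 ≤ κ) (b : Fin 1) : WRS κ d0 (L1 b) 1 :=
  Literature.MathematicalPhysics.QuantumFieldTheory.Balaban1983to89.B13PerturbativeStep.WRS.one (weightHyp_zero hκ)

/-! ## The hand-off is inhabited -/

/-- **NON-VACUITY OF THE HAND-OFF**: the conclusion of `rowData_decFamilyΩ` is inhabited on the toy data — obtained by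
APPLYING the theorem, every one of its binders discharged (rate `κ = 0`, `κ₁ = 1`, `M = N = C_L = r = R = 1`,
`K₁″ = Φ = D = D_f = 0`, `P = 1`, `τ ≡ 1`, free coordinate `Δ₀ = 0`). [folklore] -/
theorem rowData_witness :
    RowData 0 d0 (Real.exp 1) (decFamilyΩ (fun y : Fin 1 => y) E1 Dω0 h1 K0 near0 L1 (fun _ => (1 : ℂ)) 0)
      (decMajΩ (Real.exp (1 * (1 : ℕ))) (1 * ((1 : ℕ) / 1)) d0 cr0 h1 K0 near0 L1)
      (Real.exp (1 * (1 : ℕ)) * (1 * 1) * (1 - 1 * (2 * 1 / 1 * 0 + 0))⁻¹) := by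
  refine rowData_decFamilyΩ (κ := 0) (weightHyp_zero le_rfl) (fun _ _ => rfl) K0 Dω0 (fun ω k l hk => ?_) near0 h1 E1
    L1 (fun b y hy => absurd (Finset.mem_univ y) hy) (fun b y => by simp [h1]) (M := 1) (N := 1) (C_L := 1) (K₁ := 0)
    (Φ := 0) (κ₁ := 1) (r := 1) (D := 0) (Df := 0) (R := 1) one_pos (fun b y y' => by simp [h1, d0]) (fun y => ?_)
    zero_le_one zero_le_one one_pos (by norm_num) (by norm_num) (fun y : Fin 1 => y) (P := 1) (fun a => ?_)
    (fun b z _ z' _ => le_of_eq rfl) thr0 (fun ω z hz => absurd hz (Finset.notMem_empty z)) cr0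
    (fun ω => by simp [thr0, listLen, cr0]) (fun b => ?_) (fun k => ?_) (fun k => ?_) (by norm_num) (fun _ => (1 : ℂ))
    (fun δ => by rw [norm_one]; exact (Real.one_lt_exp_iff.2 one_pos).le) 0
  · simp [K0] at hk
  · have hc := Finset.card_filter_le (Finset.univ : Finset (Fin 1)) (fun b => y ∈ E1 b)
    rw [Finset.card_univ, Fintype.card_fin] at hc
    exact_mod_cast hc
  · exact ⟨Finset.univ, by simp, fun z _ => Finset.mem_univ _⟩
  · simpa using wrs_L1 (κ := 0 + 1 * ((1 : ℕ) / 1)) (by norm_num) b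
  · simp [K0]
  · simp [K0]

/-! ## The identification at `s ≡ 1` is inhabited -/

/-- The resummation hypotheses hold on the toy data: `(1 + Ktot K0)·Ptot = 1 − Rem₂`. [folklore] -/
theorem hid_witness : (1 + Ktot K0) * Ptot h1 L1 = 1 - Rem₂ h1 K0 near0 L1 :=
  resummation_identity₂ K0 near0 h1 E1 L1 (fun y => by simp [h1]) (fun b y hy => absurd (Finset.mem_univ y) hy)
    (fun b => by
      have : Pj E1 b = (1 : Matrix (Fin 1) (Fin 1) ℂ) := by
        ext i j
        obtain rfl : i = j := Subsingleton.elim i j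
        simp [Pj, E1, Fin.fin_one_eq_zero i]
      rw [this, Matrix.one_mul])
    (fun b => by
      have hP : Pj E1 b = (1 : Matrix (Fin 1) (Fin 1) ℂ) := by
        ext i j
        obtain rfl : i = j := Subsingleton.elim i j
        simp [Pj, E1, Fin.fin_one_eq_zero i]
      have hK : Knear K0 near0 b = 0 := by simp [Knear, near0]
      rw [hP, hK, add_zero, L1, Matrix.one_mul, Matrix.one_mul, Matrix.one_mul])

/-- The remainder vanishes on the toy data (the only piece is the zero kernel). [folklore] -/
theorem rem_witness : Rem₂ h1 K0 near0 L1 = 0 := by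
  unfold Rem₂ stepPiece pieceA
  simp [K0]

/-- **NON-VACUITY OF THE IDENTIFICATION**: `termSum (decFamilyΩ … 1 0) 1 = (1 + Ktot K0)⁻¹` on the toy data, by
`termSum_decFamilyΩ_one` with the row data of `rowData_witness` (whose disc of radius `e` contains `1`). [folklore] -/
theorem termSum_witness :
    termSum (decFamilyΩ (fun y : Fin 1 => y) E1 Dω0 h1 K0 near0 L1 (fun _ => (1 : ℂ)) 0) 1 = (1 + Ktot K0)⁻¹ := by
  have hRem : WRS 0 d0 (Rem₂ h1 K0 near0 L1) 0 := by
    rw [rem_witness]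
    intro i
    simp [wrs]
  refine termSum_decFamilyΩ_one (κ := 0) (weightHyp_zero le_rfl) hid_witness hRem zero_lt_one (fun y : Fin 1 => y)
    E1 Dω0 0 rowData_witness ?_
  rw [mem_ball_zero_iff, norm_one]
  exact Real.one_lt_exp_iff.2 one_pos

end

end Summit.QuantumFields.BalabanUV.Beta.UnitLatticeOmegaWitness
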